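import Summits.RiemannHypothesis.RiemannHypothesis.Theorems.GroundBartaEvenWinsBeyondArchDeflationWeightedRitz
import Summits.RiemannHypothesis.RiemannHypothesis.Theorems.GroundBartaEvenWinsBeyondArchDeflationWindowImageAE
import Summits.RiemannHypothesis.RiemannHypothesis.Theorems.GroundBartaEvenWinsBeyondArchDeflationMajorantCut
import HarnessLib

/-!
# RiemannHypothesis / GroundBarta — rung 4 (`EvenWinsBeyondArch`, stmt-RiemannHypothesis-18807 / 18085):
# the weighted deflated Temple L-side with trial vectors CUT INSIDE the window

Helper file (`--supports stmt-RiemannHypothesis-18085`), RH-free, no definitions, no named facts.  Prover B (gen 6 of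
unit `sr-gb-rung-b`).

`dt_sector_bound_of_ritz_w` (prover A, `…DeflationWeightedRitz`) takes `C²` × indicator trial vectors whose support IS
the test window `[-c, c]`.  For the ENDPOINT CELL `a* = (log 5)/2` of the window ladder the test window is irrational
while every certified datum lives at a rational cut: the trial vectors are `v_i = 𝟙_{[-c',c']}·g_i` with `c' ≤ c`.
This file proves the same weighted deflated Temple bound for such vectors: the abstract core `dt_sector_bound_w` only
needs the vectors in the window-`c` form domain (which contains the window-`c'` one) and an `L²` window image
representing the closed form, and the latter is supplied by the a.e. majorant of `…DeflationMajorantCut` through the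
a.e. representation theorems of `…DeflationWindowImageAE`.

* `dt_cut_mem_formDomain` — `𝟙_{[-c',c']}·g` lies in the parity-`σ` form domain of every window `c ≥ c'`;
* **`dt_sector_bound_of_cut_w`** — `λ∫|φ|² ≤ Re Q(φ)` on smooth parity-`σ` tests of `[-c, c]`;
* `dt_weilOddGroundEnergy_ge_of_cut_w`, `dt_weilEvenGroundEnergy_ge_of_cut_w` — `λ ≤ ε_od(c)`, `λ ≤ ε_ev(c)`.
-/

set_option linter.dupNamespace false

noncomputable section

open MeasureTheory Set Filter
open scoped Topology ENNReal NNReal ComplexConjugate BigOperators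

namespace Summit.RiemannHypothesis.RiemannHypothesis.Theorems.EvenWinsBeyondArch

open Literature.NumberTheory.LFunctions Literature.NumberTheory.LFunctions.ConnesVanSuijlekom
open Summit.RiemannHypothesis.RiemannHypothesis.Theorems.OddSector (weilDirichletEnergy₂ weilPoleForm₂)

/-- **A cut `C¹` vector lies in the form domain of every larger window**: for `0 < c' ≤ c`, `g ∈ C¹` with
`g(-x) = σ g(x)` and `v = 𝟙_{[-c',c']}·g`: `v ∈ L²`, `v = 0` off `[-c, c]`, `v` is real, `v(-x) = σ v(x)`, and the
archimedean energy of `v` is finite. [folklore] -/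
theorem dt_cut_mem_formDomain {c c' : ℝ} (hc' : 0 < c') (hcc : c' ≤ c) (σ : ℝ) {g : ℝ → ℝ} (hg : ContDiff ℝ 1 g)
    (hgp : ∀ x, g (-x) = σ * g x) {v : ℝ → ℂ} (hv : ∀ x, v x = (((Icc (-c') c').indicator g x : ℝ) : ℂ)) :
    MemLp v 2 ∧ (∀ x, x ∉ Icc (-c) c → v x = 0) ∧ (∀ x, (v x).im = 0) ∧ (∀ x, v (-x) = (σ : ℂ) * v x) ∧
      IntegrableOn (fun t ↦ weilArchDensity t * weilIncrement v t) (Ioi 0) := by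
  have hveq : v = fun x ↦ (((Icc (-c') c').indicator g x : ℝ) : ℂ) := funext hv
  obtain ⟨h1, h2, h3, h4⟩ := dt_indicator_mul_mem_formDomain hc' hg
  refine ⟨by rw [hveq]; exact h1, fun x hx ↦ ?_, fun x ↦ by rw [hv x]; exact h3 x, fun x ↦ ?_, by rw [hveq]; exact h4⟩
  · rw [hv x]
    exact h2 x fun h ↦ hx (Icc_subset_Icc (by linarith) hcc h)
  · rw [hv (-x), hv x]
    have hsym : (-x ∈ Icc (-c') c') ↔ (x ∈ Icc (-c') c') := by
      simp only [mem_Icc]; constructor <;> rintro ⟨h₁, h₂⟩ <;> constructor <;> linarith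
    by_cases hx : x ∈ Icc (-c') c'
    · rw [indicator_of_mem (hsym.2 hx), indicator_of_mem hx, hgp x]; push_cast; ring
    · rw [indicator_of_notMem (fun h ↦ hx (hsym.1 h)), indicator_of_notMem hx]; simp

/-- **The weighted deflated Temple bound from `C²` vectors cut inside the window, parity `σ`.**  As
`dt_sector_bound_of_ritz_w` (inputs: trial vectors, their window-`c` images `F_i`, any `W`, penalty weights `μ ≥ 0`,
the pointwise complement level `n + λ` with `w = 1/n`, the complement certificate `hcert` on smooth parity-`σ` tests
of `[-c, c]`, and the PSD datum `A − λG − R_w ⪰ 0`), except that the vectors are `v_i = 𝟙_{[-c',c']}·g_i` with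
`0 < c' ≤ c`.  Conclusion: `λ∫|φ|² ≤ Re Q(φ)` for every smooth `φ` supported in `[-c, c]` with `φ(-x) = σφ(x)`.
[cite: WeinsteinStenger1972, Ch. 5 §9 eq. (2) (k = 1: Temple's formula)] -/
theorem dt_sector_bound_of_cut_w {c c' : ℝ} (hc' : 0 < c') (hcc : c' ≤ c) (σ : ℝ) {k : ℕ}
    (g : Fin k → ℝ → ℝ) (hg : ∀ i, ContDiff ℝ 2 (g i)) (hgp : ∀ i x, g i (-x) = σ * g i x)
    (v F : Fin k → ℝ → ℂ) (hv : ∀ i x, v i x = (((Icc (-c') c').indicator (g i) x : ℝ) : ℂ))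
    (hF : ∀ i y, F i y = (Icc (-c) c).indicator (fun y ↦
        2 * (∫ x, v i x * (Real.cosh (x / 2) : ℂ)) * (Real.cosh (y / 2) : ℂ) -
          2 * (∫ x, v i x * (Real.sinh (x / 2) : ℂ)) * (Real.sinh (y / 2) : ℂ) +
        (∑ n ∈ weilPrimeIndex c, (((ArithmeticFunction.vonMangoldt n : ℝ) / Real.sqrt n : ℝ) : ℂ) *
          (2 * v i y - v i (y - Real.log n) - v i (y + Real.log n))) +
        ∫ t in Ioi 0, (weilArchDensity t : ℂ) * (2 * v i y - v i (y - t) - v i (y + t))) y -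
      (weilMarkovConstant c : ℂ) * v i y)
    (W : Fin k → Fin k → ℝ) (μ : Fin k → ℝ) (lam : ℝ) (hμ : ∀ i, 0 ≤ μ i)
    {n w : ℝ → ℝ} (hnm : Measurable n) (hwm : Measurable w) {C : ℝ} (hnC : ∀ y, |n y| ≤ C) (hwC : ∀ y, |w y| ≤ C)
    (hn0 : ∀ y, 0 ≤ n y) (hw0 : ∀ y, 0 ≤ w y) (hwn : ∀ y, w y * n y = 1)
    (hcert : ∀ φ : ℝ → ℂ, IsWeilTest φ → tsupport φ ⊆ Icc (-c) c → (∀ x, φ (-x) = (σ : ℂ) * φ x) →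
      (∫ y, n y * ‖φ y‖ ^ 2) + lam * ∫ x, ‖φ x‖ ^ 2 ≤
        (weilQuadratic φ).re + ∑ i, μ i * ‖∫ x, φ x * conj (v i x)‖ ^ 2)
    (hPSD : ∀ α : Fin k → ℝ, 0 ≤ ∑ i, ∑ j, α i * α j *
      ((weilPoleForm₂ (v i) (v j) + weilDirichletEnergy₂ c (v i) (v j) -
          weilMarkovConstant c * ∫ x, (v i x * conj (v j x)).re) - lam * (∫ x, (v i x * conj (v j x)).re) -
        ∫ y, w y * ((F i - ∑ l, W i l • v l) y * conj ((F j - ∑ l, W j l • v l) y)).re))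
    {φ : ℝ → ℂ} (hφ : IsWeilTest φ) (hφs : tsupport φ ⊆ Icc (-c) c) (hφp : ∀ x, φ (-x) = (σ : ℂ) * φ x) :
    lam * ∫ x, ‖φ x‖ ^ 2 ≤ (weilQuadratic φ).re := by
  have hc : 0 < c := lt_of_lt_of_le hc' hcc
  -- the trial vectors lie in the window-`c` sector form domain
  have hvD : ∀ i, MemLp (v i) 2 ∧ (∀ x, x ∉ Icc (-c) c → v i x = 0) ∧ (∀ x, (v i x).im = 0) ∧
      (∀ x, v i (-x) = (σ : ℂ) * v i x) ∧
      IntegrableOn (fun t ↦ weilArchDensity t * weilIncrement (v i) t) (Ioi 0) := fun i ↦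
    dt_cut_mem_formDomain hc' hcc σ ((hg i).of_le (by norm_num)) (hgp i) (hv i)
  -- the a.e. majorant of the cut vectors on the test window
  have hmaj : ∀ i, ∃ m : ℝ → ℝ, MemLp m 2 volume ∧
      (∀ᵐ y : ℝ, y ∈ Ioo (-c) c →
        IntegrableOn (fun t ↦ weilArchDensity t * ‖2 * v i y - v i (y - t) - v i (y + t)‖) (Ioi 0) ∧
          ∫ t in Ioi 0, weilArchDensity t * ‖2 * v i y - v i (y - t) - v i (y + t)‖ ≤ m y) :=
    fun i ↦ dt_exists_majorant_of_contDiff_cut hc' hcc (hg i) (hv i)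
  have hFm : ∀ i, MemLp (F i) 2 := by
    intro i
    obtain ⟨m, hm, hH⟩ := hmaj i
    exact dt_windowImage_memLp_ae (hvD i).1 hm hH (hF i)
  have hrepr : ∀ i (f : ℝ → ℂ), MemLp f 2 → (∀ x, x ∉ Icc (-c) c → f x = 0) → (∀ x, (f x).im = 0) →
      (∀ x, f (-x) = (σ : ℂ) * f x) →
      IntegrableOn (fun t ↦ weilArchDensity t * weilIncrement f t) (Ioi 0) →
      weilPoleForm₂ (v i) f + weilDirichletEnergy₂ c (v i) f -
          weilMarkovConstant c * ∫ x, (v i x * conj (f x)).re = ∫ x, (F i x * conj (f x)).re := by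
    intro i f hf hfs _ _ _
    obtain ⟨m, hm, hH⟩ := hmaj i
    exact dt_windowImage_repr_ae (hvD i).1 hm hH (hF i) hf hfs
  exact dt_sector_bound_w hc σ v F W μ lam hμ hnm hwm hnC hwC hn0 hw0 hwn hvD hFm hrepr hcert hPSD hφ hφs hφp

/-- **Weighted deflated Temple lower bound for `ε_od(c)` from odd `C²` vectors cut inside the window**:
`λ ≤ weilOddGroundEnergy c`. [cite: WeinsteinStenger1972, Ch. 5 §9 eq. (2) (k = 1: Temple's formula)] -/
theorem dt_weilOddGroundEnergy_ge_of_cut_w {c c' : ℝ} (hc' : 0 < c') (hcc : c' ≤ c) {k : ℕ}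
    (g : Fin k → ℝ → ℝ) (hg : ∀ i, ContDiff ℝ 2 (g i)) (hgo : ∀ i x, g i (-x) = -g i x)
    (v F : Fin k → ℝ → ℂ) (hv : ∀ i x, v i x = (((Icc (-c') c').indicator (g i) x : ℝ) : ℂ))
    (hF : ∀ i y, F i y = (Icc (-c) c).indicator (fun y ↦
        2 * (∫ x, v i x * (Real.cosh (x / 2) : ℂ)) * (Real.cosh (y / 2) : ℂ) -
          2 * (∫ x, v i x * (Real.sinh (x / 2) : ℂ)) * (Real.sinh (y / 2) : ℂ) +
        (∑ n ∈ weilPrimeIndex c, (((ArithmeticFunction.vonMangoldt n : ℝ) / Real.sqrt n : ℝ) : ℂ) *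
          (2 * v i y - v i (y - Real.log n) - v i (y + Real.log n))) +
        ∫ t in Ioi 0, (weilArchDensity t : ℂ) * (2 * v i y - v i (y - t) - v i (y + t))) y -
      (weilMarkovConstant c : ℂ) * v i y)
    (W : Fin k → Fin k → ℝ) (μ : Fin k → ℝ) (lam : ℝ) (hμ : ∀ i, 0 ≤ μ i)
    {n w : ℝ → ℝ} (hnm : Measurable n) (hwm : Measurable w) {C : ℝ} (hnC : ∀ y, |n y| ≤ C) (hwC : ∀ y, |w y| ≤ C)
    (hn0 : ∀ y, 0 ≤ n y) (hw0 : ∀ y, 0 ≤ w y) (hwn : ∀ y, w y * n y = 1)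
    (hcert : ∀ φ : ℝ → ℂ, IsWeilTest φ → tsupport φ ⊆ Icc (-c) c → (∀ x, φ (-x) = -φ x) →
      (∫ y, n y * ‖φ y‖ ^ 2) + lam * ∫ x, ‖φ x‖ ^ 2 ≤
        (weilQuadratic φ).re + ∑ i, μ i * ‖∫ x, φ x * conj (v i x)‖ ^ 2)
    (hPSD : ∀ α : Fin k → ℝ, 0 ≤ ∑ i, ∑ j, α i * α j *
      ((weilPoleForm₂ (v i) (v j) + weilDirichletEnergy₂ c (v i) (v j) -
          weilMarkovConstant c * ∫ x, (v i x * conj (v j x)).re) - lam * (∫ x, (v i x * conj (v j x)).re) -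
        ∫ y, w y * ((F i - ∑ l, W i l • v l) y * conj ((F j - ∑ l, W j l • v l) y)).re)) :
    lam ≤ weilOddGroundEnergy c := by
  have hc : 0 < c := lt_of_lt_of_le hc' hcc
  refine le_weilOddGroundEnergy_of_forall hc fun φ hφ hφs hφo hφn ↦ ?_
  have h := dt_sector_bound_of_cut_w hc' hcc (-1) g hg (fun i x ↦ by rw [hgo i x]; ring) v F hv hF W μ lam hμ
    hnm hwm hnC hwC hn0 hw0 hwn (fun φ hφ hφs hφp ↦ hcert φ hφ hφs (fun x ↦ by simpa using hφp x)) hPSD hφ hφs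
    (fun x ↦ by simpa using hφo x)
  rwa [hφn, mul_one] at h

/-- **Weighted deflated Temple lower bound for `ε_ev(c)` from even `C²` vectors cut inside the window**:
`λ ≤ weilEvenGroundEnergy c`. [cite: WeinsteinStenger1972, Ch. 5 §9 eq. (2) (k = 1: Temple's formula)] -/
theorem dt_weilEvenGroundEnergy_ge_of_cut_w {c c' : ℝ} (hc' : 0 < c') (hcc : c' ≤ c) {k : ℕ}
    (g : Fin k → ℝ → ℝ) (hg : ∀ i, ContDiff ℝ 2 (g i)) (hge : ∀ i x, g i (-x) = g i x)
    (v F : Fin k → ℝ → ℂ) (hv : ∀ i x, v i x = (((Icc (-c') c').indicator (g i) x : ℝ) : ℂ))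
    (hF : ∀ i y, F i y = (Icc (-c) c).indicator (fun y ↦
        2 * (∫ x, v i x * (Real.cosh (x / 2) : ℂ)) * (Real.cosh (y / 2) : ℂ) -
          2 * (∫ x, v i x * (Real.sinh (x / 2) : ℂ)) * (Real.sinh (y / 2) : ℂ) +
        (∑ n ∈ weilPrimeIndex c, (((ArithmeticFunction.vonMangoldt n : ℝ) / Real.sqrt n : ℝ) : ℂ) *
          (2 * v i y - v i (y - Real.log n) - v i (y + Real.log n))) +
        ∫ t in Ioi 0, (weilArchDensity t : ℂ) * (2 * v i y - v i (y - t) - v i (y + t))) y -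
      (weilMarkovConstant c : ℂ) * v i y)
    (W : Fin k → Fin k → ℝ) (μ : Fin k → ℝ) (lam : ℝ) (hμ : ∀ i, 0 ≤ μ i)
    {n w : ℝ → ℝ} (hnm : Measurable n) (hwm : Measurable w) {C : ℝ} (hnC : ∀ y, |n y| ≤ C) (hwC : ∀ y, |w y| ≤ C)
    (hn0 : ∀ y, 0 ≤ n y) (hw0 : ∀ y, 0 ≤ w y) (hwn : ∀ y, w y * n y = 1)
    (hcert : ∀ φ : ℝ → ℂ, IsWeilTest φ → tsupport φ ⊆ Icc (-c) c → (∀ x, φ (-x) = φ x) →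
      (∫ y, n y * ‖φ y‖ ^ 2) + lam * ∫ x, ‖φ x‖ ^ 2 ≤
        (weilQuadratic φ).re + ∑ i, μ i * ‖∫ x, φ x * conj (v i x)‖ ^ 2)
    (hPSD : ∀ α : Fin k → ℝ, 0 ≤ ∑ i, ∑ j, α i * α j *
      ((weilPoleForm₂ (v i) (v j) + weilDirichletEnergy₂ c (v i) (v j) -
          weilMarkovConstant c * ∫ x, (v i x * conj (v j x)).re) - lam * (∫ x, (v i x * conj (v j x)).re) -
        ∫ y, w y * ((F i - ∑ l, W i l • v l) y * conj ((F j - ∑ l, W j l • v l) y)).re)) :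
    lam ≤ weilEvenGroundEnergy c := by
  have hc : 0 < c := lt_of_lt_of_le hc' hcc
  refine le_weilEvenGroundEnergy_of_forall hc fun φ hφ hφs hφe hφn ↦ ?_
  have h := dt_sector_bound_of_cut_w hc' hcc 1 g hg (fun i x ↦ by rw [hge i x]; ring) v F hv hF W μ lam hμ
    hnm hwm hnC hwC hn0 hw0 hwn (fun φ hφ hφs hφp ↦ hcert φ hφ hφs (fun x ↦ by simpa using hφp x)) hPSD hφ hφs
    (fun x ↦ by simpa using hφe x)
  rwa [hφn, mul_one] at h

end Summit.RiemannHypothesis.RiemannHypothesis.Theorems.EvenWinsBeyondArch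

end
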